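import Summits.CriticalPhenomena.PercolationContinuityZ3.Theorems.SoloBlindPeriodicFinChains
import Summits.CriticalPhenomena.PercolationContinuityZ3.Theorems.SoloBlindOpenRungs
import Mathlib.Analysis.SpecificLimits.Basic
import HarnessLib

/-!
# Fins attached along a periodic set of feet, II: no percolation at `p_c` under `LineRate`

Seat `solo-CriticalPhenomena-blind`.  **Theorem (`periodicFin_of_lineRate`).** Assume
`LineRate`: `Σ_z P_{p_c}(0 ↔ (0,0,z) inside ℍ) < ∞` (`SoloBlindOpenRungs.LineRate`).  Then there
is `M₀` such that for every period `M ≥ M₀` the region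
`S_{Mℤ} = ℍ ∪ {x₁ = 0, x₀ ≤ -2} ∪ {(-1,0,Mj) : j ∈ ℤ}` — a half-space with a half-plane glued on
along a POSITIVE-DENSITY set of feet — has `θ(p_c(ℤ³)) = 0` at the origin (as an induced subgraph).
This is the first rung beyond Borel–Cantelli-sparse attachments (`SoloBlindSparseFins`): it is
reached by the BK alternating-chain bound of `SoloBlindChainBK`/`SoloBlindPeriodicFinChains`
(an infinite cluster forces disjointly occurring alternating chains of every length), a kernel
iteration (`kerSup_succ_le`: each fin step costs `κ_F(M) → 0` by planar exponential decay
`exists_exp_decay_finFeet`, each `ℍ` step costs `κ_ℍ ≤ 1 + Σ_z τ_ℍ(0,(0,0,z)) < ∞` by `LineRate`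
and translation invariance), and `κ_ℍ κ_F(M) < 1` for large `M`.
-/

noncomputable section

namespace Summit.CriticalPhenomena.PercolationContinuityZ3.Theorems

open MeasureTheory Filter Topology Literature.Probability.Percolation Literature.Probability.LatticeModels
open scoped ENNReal

/-! ### Kernel iteration on `ℤ` with two alternating sides -/

section Kernel

variable (κ : Bool → ℤ → ℤ → ℝ≥0∞)

/-- Iterated kernel weight of a height sequence, started on side `s` at height `z`. -/
def kerW : (n : ℕ) → Bool → ℤ → (Fin n → ℤ) → ℝ≥0∞
  | 0, _, _, _ => 1
  | n + 1, s, z, f => κ s z (f 0) * kerW n (!s) (f 0) (Fin.tail f)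

/-- Total weight of all height sequences of length `n` from `(s, z)`. -/
def kerR (n : ℕ) (s : Bool) (z : ℤ) : ℝ≥0∞ := ∑' f : Fin n → ℤ, kerW κ n s z f

/-- Its supremum over the starting height. -/
def kerSup (n : ℕ) (s : Bool) : ℝ≥0∞ := ⨆ z : ℤ, kerR κ n s z

/-- The kernel norm `sup_z Σ_{z'} κ_s(z, z')`. -/
def kerTot (s : Bool) : ℝ≥0∞ := ⨆ z : ℤ, ∑' z' : ℤ, κ s z z'

/-- Head/tail splitting of height sequences. -/
def headTail (n : ℕ) : (Fin (n + 1) → ℤ) ≃ ℤ × (Fin n → ℤ) where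
  toFun f := (f 0, Fin.tail f)
  invFun p := Fin.cons p.1 p.2
  left_inv f := Fin.cons_self_tail f
  right_inv p := by simp

/-- Summation over height sequences = summation over the head and the tail. -/
theorem tsum_headTail {n : ℕ} (F : (Fin (n + 1) → ℤ) → ℝ≥0∞) :
    ∑' f, F f = ∑' z : ℤ, ∑' g : Fin n → ℤ, F (Fin.cons z g) := by
  rw [← (headTail n).symm.tsum_eq, ENNReal.tsum_prod']
  rfl

/-- Length-`0` total weight is `1`. -/
theorem kerR_zero (s : Bool) (z : ℤ) : kerR κ 0 s z = 1 := by
  rw [kerR, tsum_fintype, Fintype.sum_unique]; rfl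

/-- The kernel recursion for total weights. -/
theorem kerR_succ (n : ℕ) (s : Bool) (z : ℤ) :
    kerR κ (n + 1) s z = ∑' z' : ℤ, κ s z z' * kerR κ n (!s) z' := by
  rw [kerR, tsum_headTail]
  refine tsum_congr fun z' => ?_
  rw [kerR, ← ENNReal.tsum_mul_left]
  refine tsum_congr fun g => ?_
  simp [kerW]

/-- Length-`0` sup weight is `1`. -/
theorem kerSup_zero (s : Bool) : kerSup κ 0 s = 1 := by
  simp [kerSup, kerR_zero]

/-- One kernel step costs at most the kernel norm. -/
theorem kerSup_succ_le (n : ℕ) (s : Bool) : kerSup κ (n + 1) s ≤ kerTot κ s * kerSup κ n (!s) := by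
  refine iSup_le fun z => ?_
  rw [kerR_succ]
  calc ∑' z', κ s z z' * kerR κ n (!s) z'
      ≤ ∑' z', κ s z z' * kerSup κ n (!s) :=
        ENNReal.tsum_le_tsum fun z' => mul_le_mul' le_rfl (le_iSup (fun w => kerR κ n (!s) w) z')
    _ = (∑' z', κ s z z') * kerSup κ n (!s) := ENNReal.tsum_mul_right
    _ ≤ kerTot κ s * kerSup κ n (!s) :=
        mul_le_mul' (le_iSup (fun w => ∑' z', κ s w z') z) le_rfl

/-- Two alternating kernel steps cost at most the product of the two kernel norms. -/
theorem kerSup_two_mul_le (s : Bool) : ∀ m : ℕ, kerSup κ (2 * m) s ≤ (kerTot κ s * kerTot κ (!s)) ^ m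
  | 0 => by simp [kerSup_zero]
  | m + 1 => by
    have h2 : 2 * (m + 1) = 2 * m + 1 + 1 := by ring
    rw [h2, pow_succ']
    calc kerSup κ (2 * m + 1 + 1) s
        ≤ kerTot κ s * kerSup κ (2 * m + 1) (!s) := kerSup_succ_le κ _ s
      _ ≤ kerTot κ s * (kerTot κ (!s) * kerSup κ (2 * m) (!!s)) :=
          mul_le_mul' le_rfl (kerSup_succ_le κ _ (!s))
      _ ≤ kerTot κ s * kerTot κ (!s) * (kerTot κ s * kerTot κ (!s)) ^ m := by
          rw [Bool.not_not, mul_assoc]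
          exact mul_le_mul' le_rfl (mul_le_mul' le_rfl (kerSup_two_mul_le s m))

/-- The start: total weight `Σ_f γ(f₀) W(f)` is at most `(Σ γ) · kerSup`. -/
theorem tsum_start_le (γ : ℤ → ℝ≥0∞) (n : ℕ) (s : Bool) :
    ∑' f : Fin (n + 1) → ℤ, γ (f 0) * kerW κ n s (f 0) (Fin.tail f) ≤ (∑' z, γ z) * kerSup κ n s := by
  rw [tsum_headTail]
  simp only [Fin.cons_zero, Fin.tail_cons]
  calc ∑' z, ∑' g : Fin n → ℤ, γ z * kerW κ n s z g
      = ∑' z, γ z * kerR κ n s z := tsum_congr fun z => by rw [kerR, ENNReal.tsum_mul_left]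
    _ ≤ ∑' z, γ z * kerSup κ n s :=
        ENNReal.tsum_le_tsum fun z => mul_le_mul' le_rfl (le_iSup (fun w => kerR κ n s w) z)
    _ = (∑' z, γ z) * kerSup κ n s := ENNReal.tsum_mul_right

end Kernel

/-! ### The chain weights of `S_Z` -/

section Weights

variable (Z : Set ℤ)

/-- `P_{p_c}` on `ℤ³`. -/
def Pc : Measure (BondConfig (Site 3)) := bondPercolation (zdGraph 3) (criticalProbI 3)

/-- `P_{p_c}` is a probability measure. -/
instance isProbabilityMeasure_Pc : IsProbabilityMeasure Pc := by unfold Pc; infer_instance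

/-- The admissibility indicator `1[z ∈ Z, z' ∈ Z, z' ≠ z]`. -/
def admInd (z z' : ℤ) : ℝ≥0∞ :=
  Set.indicator {q : ℤ × ℤ | q.1 ∈ Z ∧ q.2 ∈ Z ∧ q.2 ≠ q.1} (fun _ => 1) (z, z')

/-- The one-step kernel: admissibility × `P(cpt s z ↔ cpt s z' via K₀)` × `P(connector z' open)`. -/
def kerZ (s : Bool) (z z' : ℤ) : ℝ≥0∞ :=
  admInd Z z z' * (Pc (openConnVia (K0 Z) (cpt s z) (cpt s z')) *
    Pc {ω | s(cpt s z', cpt (!s) z') ∈ ω})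

/-- The start weight from `x`: `1[z ∈ Z] × P(x ↔ cpt s z via K₀) × P(connector z open)`. -/
def startZ (x : Site 3) (s : Bool) (z : ℤ) : ℝ≥0∞ :=
  Set.indicator Z (fun _ => 1) z * (Pc (openConnVia (K0 Z) x (cpt s z)) *
    Pc {ω | s(cpt s z, cpt (!s) z) ∈ ω})

/-- The product of the chain-event probabilities. -/
def chainW : Site 3 → (n : ℕ) → Bool → (Fin n → ℤ) → ℝ≥0∞
  | _, 0, _, _ => 1
  | a, n + 1, s, f => Pc (openConnVia (K0 Z) a (cpt s (f 0))) *
      Pc {ω | s(cpt s (f 0), cpt (!s) (f 0)) ∈ ω} * chainW (cpt (!s) (f 0)) n (!s) (Fin.tail f)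

/-- The chain weight is the product of the probabilities of the chain events. -/
theorem chainW_eq_prod : ∀ (n : ℕ) (a : Site 3) (s : Bool) (f : Fin n → ℤ),
    chainW Z a n s f = ((chainEvents (K0 Z) a (mkChain n s f)).map Pc).prod
  | 0, _, _, _ => by simp [chainW]
  | n + 1, a, s, f => by
    rw [chainW, mkChain_succ, chainEvents_cons, List.map_cons, List.map_cons, List.prod_cons,
      List.prod_cons, chainW_eq_prod n, crossE_fst, crossE_snd, mul_assoc]

variable {Z}

/-- The admissibility indicator of an admissible pair is `1`. -/
theorem admInd_of_mem {z z' : ℤ} (hz : z ∈ Z) (hz' : z' ∈ Z) (hne : z' ≠ z) : admInd Z z z' = 1 :=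
  Set.indicator_of_mem (show (z, z') ∈ {q : ℤ × ℤ | q.1 ∈ Z ∧ q.2 ∈ Z ∧ q.2 ≠ q.1} from ⟨hz, hz', hne⟩) _

/-- The admissibility indicator is at most `1`. -/
theorem admInd_le_one (z z' : ℤ) : admInd Z z z' ≤ 1 :=
  Set.indicator_le_self' (fun _ _ => zero_le_one) _ |>.trans le_rfl

/-- The admissibility indicator of a non-admissible pair is `0`. -/
theorem admInd_eq_zero {z z' : ℤ} (h : ¬(z ∈ Z ∧ z' ∈ Z ∧ z' ≠ z)) : admInd Z z z' = 0 :=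
  Set.indicator_of_notMem (by simpa using h) _

/-- On admissible sequences the kernel weight is the chain weight. -/
theorem kerW_eq_chainW : ∀ (n : ℕ) (s : Bool) {z : ℤ} (f : Fin n → ℤ), z ∈ Z → f ∈ admSet Z n z →
    kerW (kerZ Z) n s z f = chainW Z (cpt s z) n s f
  | 0, _, _, _, _, _ => rfl
  | n + 1, s, z, f, hz, hf => by
    obtain ⟨h0, hne, htail⟩ := (mem_admSet_succ Z n z f).1 hf
    rw [kerW, chainW, kerZ, admInd_of_mem hz h0 hne, one_mul, kerW_eq_chainW n (!s) _ h0 htail,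
      mul_assoc]

/-- Start weight times kernel weight is the chain weight, on start-admissible sequences. -/
theorem start_mul_kerW_eq_chainW (n : ℕ) (x : Site 3) (s : Bool) (f : Fin (n + 1) → ℤ)
    (hf : f ∈ admSet₀ Z (n + 1)) :
    startZ Z x s (f 0) * kerW (kerZ Z) n (!s) (f 0) (Fin.tail f) = chainW Z x (n + 1) s f := by
  obtain ⟨h0, htail⟩ := (mem_admSet₀_succ Z n f).1 hf
  rw [startZ, Set.indicator_of_mem h0, one_mul, kerW_eq_chainW n (!s) _ h0 htail, chainW, mul_assoc]

/-- **The chain bound.** For `x` on side `s`, for every `n`,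
`P(x ↔ ∞ in S_Z) ≤ Σ_f startZ(f₀) · kerW(f)` over height sequences of length `n + 1`. -/
theorem measure_percolatesVia_le_tsum (x : Site 3) (s : Bool) (hx : x ∈ sideSet Z s) (n : ℕ) :
    Pc (percolatesVia (KS Z) x) ≤
      ∑' f : Fin (n + 1) → ℤ, startZ Z x s (f 0) * kerW (kerZ Z) n (!s) (f 0) (Fin.tail f) := by
  classical
  let E : (Fin (n + 1) → ℤ) → Set (BondConfig (Site 3)) := fun f =>
    {ω | f ∈ admSet₀ Z (n + 1) ∧ ω ∈ disjointOccurrenceList (chainEvents (K0 Z) x (mkChain (n + 1) s f))}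
  calc Pc (percolatesVia (KS Z) x) ≤ Pc (⋃ f, E f) := by
        refine measure_mono_ae ?_
        filter_upwards [ae_forall_piece_finite Z] with ω hfin hperc
        obtain ⟨f, hf, hD⟩ := exists_adm_mem_disjointOccurrenceList s hx hfin hperc (n + 1)
        exact Set.mem_iUnion.2 ⟨f, hf, hD⟩
    _ ≤ ∑' f, Pc (E f) := measure_iUnion_le E
    _ ≤ _ := ENNReal.tsum_le_tsum fun f => ?_
  by_cases hf : f ∈ admSet₀ Z (n + 1)
  · rw [start_mul_kerW_eq_chainW n x s f hf, chainW_eq_prod]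
    refine (measure_mono ?_).trans (measure_disjointOccurrenceList_chainEvents_le _ _ _ _ _)
    exact fun ω hω => hω.2
  · have : E f = ∅ := Set.eq_empty_of_forall_notMem fun ω hω => hf hω.1
    rw [this, measure_empty]; exact zero_le

/-- **Geometric decay in the chain length**: with `Γ = Σ_z startZ` and
`ρ = kerTot(true) · kerTot(false)`, `P(x ↔ ∞ in S_Z) ≤ Γ ρ^m` for every `m`. -/
theorem measure_percolatesVia_le_pow (x : Site 3) (s : Bool) (hx : x ∈ sideSet Z s) (m : ℕ) :
    Pc (percolatesVia (KS Z) x) ≤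
      (∑' z, startZ Z x s z) * (kerTot (kerZ Z) true * kerTot (kerZ Z) false) ^ m := by
  refine (measure_percolatesVia_le_tsum x s hx (2 * m)).trans ?_
  refine (tsum_start_le (kerZ Z) (startZ Z x s) (2 * m) (!s)).trans ?_
  refine mul_le_mul' le_rfl ((kerSup_two_mul_le (kerZ Z) (!s) m).trans_eq ?_)
  cases s
  · rfl
  · simp [mul_comm]

/-- **Contraction criterion.** If `Σ_z startZ < ∞` and `kerTot(true) · kerTot(false) < 1` then
`P(x ↔ ∞ in S_Z) = 0`. -/
theorem measure_percolatesVia_eq_zero (x : Site 3) (s : Bool) (hx : x ∈ sideSet Z s)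
    (hΓ : ∑' z, startZ Z x s z ≠ ⊤) (hρ : kerTot (kerZ Z) true * kerTot (kerZ Z) false < 1) :
    Pc (percolatesVia (KS Z) x) = 0 := by
  have ht := ENNReal.Tendsto.const_mul (ENNReal.tendsto_pow_atTop_nhds_zero_of_lt_one hρ)
    (Or.inr hΓ) (a := ∑' z, startZ Z x s z)
  rw [mul_zero] at ht
  exact le_antisymm (ge_of_tendsto' ht fun m => measure_percolatesVia_le_pow x s hx m) zero_le

end Weights

end Summit.CriticalPhenomena.PercolationContinuityZ3.Theorems

end
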